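import Mathlib
import Literature.NumberTheory.Transcendental.SemialgebraicDerivativeProofs
import Literature.NumberTheory.Transcendental.SemialgebraicAlgebraicPoints
import Literature.NumberTheory.Transcendental.KZSemialgebraicComplex
import HarnessLib

/-!
# Difference quotients of one-variable Nash functions are Nash

For a function `f : ℝ → ℝ` that is `ℚ`-semialgebraic (graph a `ℚ`-semialgebraic subset of `ℝ²`,
in the tree's one-variable format `IsSemialgebraicFunOn ℚ {t : Fin 1 → ℝ | t 0 ∈ I} (fun t => f (t 0))`)
and differentiable on an open interval `I = (a, b)`, and a RATIONAL point `c ∈ I`, the difference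
quotient `dslope f c` (`x ↦ (f x − f c)/(x − c)`, extended by `f' c` at `c`, Mathlib's `dslope`)
is again `ℚ`-semialgebraic on `I` (`IsSemialgebraicFunOn.dslope_ratCast`): its graph is cut out by
the first-order formula
`(x ≠ c ∧ ∃ v u, (x, v) ∈ Γ_f ∧ u = f c ∧ y (x − c) = v − u) ∨ (x = c ∧ (x, y) ∈ Γ_{f'})`,
where `f c` is algebraic (`IsSemialgebraicFunOn.isAlgebraic_apply_one`) and `Γ_{f'}` is
`ℚ`-semialgebraic by Basu–Pollack–Roy 2006, Prop. 3.22
(`IsSemialgebraicFunOn.hasDerivAt_isSemialgebraic_holds`); quantifiers are eliminated with the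
formula kit of `SemialgebraicDerivativeProofs.lean` (Tarski–Seidenberg). If `f` is real-analytic,
so is `dslope f c` (`analyticAt_dslope_of_analyticAt`: power series of `dslope` at the base point,
quotient rule elsewhere), hence `dslope` preserves Nash functions of one variable. Also recorded:
real powers of positive real-analytic functions are real-analytic (`analyticAt_rpow_const_comp`).
These are the division-by-a-coordinate steps of kernel constructions in the Kontsevich–Zagier
dilation pencil (`KZDilationLogSector.lean`).

## References

* S. Basu, R. Pollack, M.-F. Roy, *Algorithms in Real Algebraic Geometry*, 2nd ed., Springer
  (2006), §3.5 Prop. 3.22, §2.5.1 Cor. 2.78. [`BasuPollackRoy2006`]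
* J. Bochnak, M. Coste, M.-F. Roy, *Real Algebraic Geometry*, Springer (1998), §2.2 (Def. 2.2.5,
  Prop. 2.2.6), §2.9. [`BochnakCosteRoy1998`]

Everything is proved; no `def`, no named fact.
-/

noncomputable section

open Set Filter MvPolynomial
open scoped Topology
open Literature.ModelTheory.ExponentialFields

namespace Literature.NumberTheory.Transcendental

open SemialgebraicDerivative

/-! ### Graphs of one-variable semialgebraic functions -/

/-- Graph form of one-variable semialgebraicity: `t ↦ f (t 0)` is `ℚ`-semialgebraic on
`{t | t 0 ∈ I} ⊆ ℝ¹` iff the graph `{(x, f x) | x ∈ I} ⊆ ℝ²` is `ℚ`-semialgebraic.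
[cite: BochnakCosteRoy1998, Def. 2.2.5] -/
theorem IsSemialgebraicFunOn.isSemialgebraic_graph_one {I : Set ℝ} {f : ℝ → ℝ}
    (hf : IsSemialgebraicFunOn ℚ {t : Fin 1 → ℝ | t 0 ∈ I} (fun t => f (t 0))) :
    IsSemialgebraic ℚ {w : Fin 2 → ℝ | w 0 ∈ I ∧ w 1 = f (w 0)} := by
  rw [isSemialgebraicFunOn_iff] at hf
  exact hf

/-- Converse of `IsSemialgebraicFunOn.isSemialgebraic_graph_one`. [cite: BochnakCosteRoy1998, Def. 2.2.5] -/
theorem isSemialgebraicFunOn_of_isSemialgebraic_graph_one {I : Set ℝ} {f : ℝ → ℝ}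
    (hf : IsSemialgebraic ℚ {w : Fin 2 → ℝ | w 0 ∈ I ∧ w 1 = f (w 0)}) :
    IsSemialgebraicFunOn ℚ {t : Fin 1 → ℝ | t 0 ∈ I} (fun t => f (t 0)) := by
  rw [isSemialgebraicFunOn_iff]
  exact hf

/-- The polynomial atom `z 1 (z 0 − c) − (z 2 − z 3) = 0` on `ℝ⁴` (`c ∈ ℚ`) is `ℚ`-semialgebraic.
[cite: BochnakCosteRoy1998, Def. 2.1.4] -/
theorem isSemialgebraic_setOf_slope_atom (c : ℚ) :
    IsSemialgebraic ℚ {z : Fin 4 → ℝ | z 1 * (z 0 - c) - (z 2 - z 3) = 0} := by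
  convert isSemialgebraic_setOf_eval_eq_zero (k := ℚ) (R := ℝ)
    (X 1 * (X 0 - C c) - (X 2 - X 3) : MvPolynomial (Fin 4) ℚ) using 1
  ext z
  simp only [mem_setOf_eq, map_sub, map_mul, aeval_X, aeval_C, eq_ratCast]

/-! ### `dslope` -/

/-- **Difference quotients of Nash functions are semialgebraic.** If `f` is `ℚ`-semialgebraic and
differentiable on `(a, b)` and `c ∈ (a, b)` is rational, then `dslope f c` (the difference quotient
`(f x − f c)/(x − c)` extended by `f' c` at `c`) is `ℚ`-semialgebraic on `(a, b)`: its graph is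
`{(x ≠ c ∧ ∃ v u, (x, v) ∈ Γ_f ∧ u = f c ∧ y (x − c) = v − u) ∨ (x = c ∧ (x, y) ∈ Γ_{f'})}`,
where `f c` is algebraic (value of a semialgebraic function at a rational point) and `Γ_{f'}` is
semialgebraic by Basu–Pollack–Roy Prop. 3.22. [cite: BasuPollackRoy2006, Prop. 3.22] -/
theorem IsSemialgebraicFunOn.dslope_ratCast {a b : ℝ} {f f' : ℝ → ℝ} (c : ℚ) (hc : (c:ℝ) ∈ Ioo a b)
    (hf : IsSemialgebraicFunOn ℚ {t : Fin 1 → ℝ | t 0 ∈ Ioo a b} (fun t => f (t 0)))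
    (hd : ∀ x ∈ Ioo a b, HasDerivAt f (f' x) x) :
    IsSemialgebraicFunOn ℚ {t : Fin 1 → ℝ | t 0 ∈ Ioo a b} (fun t => dslope f c (t 0)) := by
  have hG := IsSemialgebraicFunOn.isSemialgebraic_graph_one hf
  have hG' := IsSemialgebraicFunOn.isSemialgebraic_graph_one (IsSemialgebraicFunOn.hasDerivAt_isSemialgebraic_holds a b f f'
    (lt_trans hc.1 hc.2) hf hd)
  have halg : IsAlgebraic ℚ (f c) := hf.isAlgebraic_apply_one hc (isAlgebraic_algebraMap c)
  apply isSemialgebraicFunOn_of_isSemialgebraic_graph_one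
  suffices key : IsSemialgebraic ℚ {w : Fin 2 → ℝ |
      (aeval w (X 0 - C c : MvPolynomial (Fin 2) ℚ) ≠ 0 ∧ ∃ v u : ℝ,
          (w 0 ∈ Ioo a b ∧ v = f (w 0)) ∧ u = f c ∧ w 1 * (w 0 - c) - (v - u) = 0) ∨
      (aeval w (X 0 - C c : MvPolynomial (Fin 2) ℚ) = 0 ∧ (w 0 ∈ Ioo a b ∧ w 1 = f' (w 0)))} by
    convert key using 1
    ext w
    simp only [mem_setOf_eq, map_sub, aeval_X, aeval_C, eq_ratCast, sub_ne_zero, sub_eq_zero]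
    by_cases h0 : w 0 = c
    · have hds : dslope f (c:ℝ) (w 0) = f' (w 0) := by
        rw [h0, dslope_same]
        exact (hd c hc).deriv
      rw [hds]
      constructor
      · rintro ⟨hI, h1⟩
        exact Or.inr ⟨h0, hI, h1⟩
      · rintro (⟨hne, -⟩ | ⟨-, hI, h1⟩)
        · exact absurd h0 hne
        · exact ⟨hI, h1⟩
    · have hne : w 0 - c ≠ 0 := sub_ne_zero.mpr h0
      have hds : dslope f (c:ℝ) (w 0) = (f (w 0) - f c) / (w 0 - c) := by
        rw [dslope_of_ne _ h0, slope_def_field]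
      rw [hds]
      constructor
      · rintro ⟨hI, h1⟩
        refine Or.inl ⟨h0, f (w 0), f c, ⟨hI, rfl⟩, rfl, ?_⟩
        rw [h1, div_mul_cancel₀ _ hne]
      · rintro (⟨-, v, u, ⟨hI, rfl⟩, rfl, h⟩ | ⟨h0', -⟩)
        · exact ⟨hI, by rw [eq_div_iff hne]; exact h⟩
        · exact absurd h0' h0
  refine IsSemialgebraic.union (sa_and (isSemialgebraic_setOf_eval_ne_zero _) ?_)
    (sa_and (isSemialgebraic_setOf_eval_eq_zero _) (sa_graph₀ hG' 0 1))
  refine sa_exists (sa_exists (sa_and (sa_graph₀ hG _ _) (sa_and ?_ ?_)))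
  · exact isSemialgebraic_setOf_apply_eq_of_isAlgebraic halg _
  · exact sa_reindex (isSemialgebraic_setOf_slope_atom c) ![0, 1, 2, 3]

/-- Difference quotients of real-analytic functions are real-analytic (at the base point: the
power series of `dslope`; elsewhere: a quotient of analytic functions). [folklore] -/
theorem analyticAt_dslope_of_analyticAt {f : ℝ → ℝ} {c x : ℝ} (hc : AnalyticAt ℝ f c) (hx : AnalyticAt ℝ f x) :
    AnalyticAt ℝ (dslope f c) x := by
  by_cases h : x = c
  · subst h
    obtain ⟨p, hp⟩ := hc
    exact ⟨_, hp.has_fpower_series_dslope_fslope⟩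
  · have h1 : AnalyticAt ℝ (slope f c) x := by
      rw [slope_fun_def_field]
      exact (hx.sub analyticAt_const).div (analyticAt_id.sub analyticAt_const) (sub_ne_zero.mpr h)
    exact h1.congr (dslope_eventuallyEq_slope_of_ne f h).symm

/-- Real powers of positive real-analytic functions are real-analytic
(`f ^ p = exp (p log f)` near the point). [folklore] -/
theorem analyticAt_rpow_const_comp {f : ℝ → ℝ} {x : ℝ} (hf : AnalyticAt ℝ f x) (hpos : 0 < f x)
    (p : ℝ) : AnalyticAt ℝ (fun y => f y ^ p) x := by
  have h : (fun y => Real.exp (Real.log (f y) * p)) =ᶠ[𝓝 x] fun y => f y ^ p := by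
    filter_upwards [hf.continuousAt.eventually (lt_mem_nhds hpos)] with y hy
    rw [Real.rpow_def_of_pos hy]
  exact (analyticAt_rexp.comp (((analyticAt_log hpos).comp hf).mul analyticAt_const)).congr h

end Literature.NumberTheory.Transcendental
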